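import Mathlib
import HarnessLib
import Summits.NavierStokesRegularity.NavierStokesRegularity.Theorems.UnthreadedRigidityDoorUnthreadedRigidityTwoShellWindowBalance
import Summits.NavierStokesRegularity.NavierStokesRegularity.Theorems.UnthreadedRigidityDoorUnthreadedRigidityPersistenceLambCurlIdentity

/-!
# Route `UnthreadedRigidityDoor`, item `UnthreadedRigidity` (W2, stmt-NavierStokesRegularity-27585) — LINE g12-1 «CO-ZONAL» / g12-2 «PERSISTENCE»:
# THE TWO-SHELL SPHERE RELATION — a toroidally balanced two-shell of opposite parity has `ψ₁ + ψ₂ − e(r)·Y₂` CONSTANT ON SPHERES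

Prover file (engine-1 g73; `--supports stmt-NavierStokesRegularity-27585 --as helper`; route-independent imports).

Second brick of the persistence road for general degree pairs (HOME engine/engine-1/HANDOFF-engine1-g73.md §1b), the two-shell analogue of es-p1's
`Persistence.sphere_transport`: if an admissible two-shell `u = twoShellL H₁ H₂ Y₁ Y₂ x₀` over solid harmonics of degrees `l₁` ODD and `l₂` EVEN is
TOROIDALLY BALANCED WITH RADIAL COEFFICIENTS, `curl(ω × u)(x₀ + y) = e₁(|y|) ∇Y₁ × y + e₂(|y|) ∇Y₂ × y` (every slice of such a WINDOW is:
`twoShell_window_toroidal_balance`, file `…TwoShellWindowBalance`), then for every `r > 0` there are constants `e, C` with, for all unit `u`,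

  `−K₁α₁(r)·r^{2l₁−2}|∇Y₁(u)|² + b₁(r)·r^{2l₁} Y₁(u)² − K₂α₂(r)·r^{2l₂−2}|∇Y₂(u)|² + b₂(r)·r^{2l₂} Y₂(u)² − e·r^{l₂} Y₂(u) = C`,

`bₗ(r) = (l/2r)((l−1)K H′ − (l+1)K′H)`, `K = vortAmpL l H`, `α = strainAmpL l H` (★ `twoShell_sphere_relation`).  MECHANISM, as for the (1,2) pair
(`MixedPair.pair_sphereLaw_b₂`): the potential shell of an odd/even-degree harmonic is even/odd in `z`, so by three curls the cross Lamb terms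
`curl(ω₁ × u₂ + ω₂ × u₁)` are ODD and drop from the EVEN part of the balance, which reads `∇ψ₁ × y + ∇ψ₂ × y = e₂(|y|) ∇Y₂ × y` with es-p1's
single-shell potentials (`Persistence.singleShellLambCurlIdentity`); then `Persistence.eq_of_cross_gradient_eq_zero_on_sphere` and the homogeneity
transport (`IsSolidHarmonic.apply_smul`, `IsSolidHarmonic.gradient_smul`).  WHAT REMAINS for `TwoShellWindowRigidity l₁ l₂` (opposite parity): the
TOP-COMPONENT lemma on solid harmonics (HANDOFF §1b) to read `b_{l₂} ≡ 0` / `K₂α₂ ≡ 0` off this relation, then the tree's `amplitudeVanishing` /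
`cubicLaw` and `singleShellWindowVanishes`.

HONEST LABEL: vector calculus of explicit SPECIAL two-shell data (support of a rung line); nothing here bears on `UnthreadedRigidity` (27585), the
door Target, W2 or Navier–Stokes regularity; no summit statement is proved.  MODEL/rung work; 0 kit.
-/


noncomputable section

-- the summit and its single sub-problem share the name (CONVENTIONS §1), as in every Theorems file
set_option linter.dupNamespace false

namespace Summit.NavierStokesRegularity.NavierStokesRegularity.Theorems.UnthreadedRigidity.MixedPair

open Set Function Filter Topology
open scoped RealInnerProductSpace ContDiff
open Literature.Analysis Literature.Analysis.FluidPDE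
open Summit.NavierStokesRegularity.NavierStokesRegularity.Theorems.UnthreadedRigidity.ProfileHorn (E3)
open Summit.NavierStokesRegularity.NavierStokesRegularity.Theorems.UnthreadedRigidity.VirialHorn
  (e IsSolidHarmonic VirialAdmissible sepShellL vortAmpL strainAmpL sepShellL_eq_comp_sub curl_comp_sub_const_fun contDiff_shell
    contDiff_top_sepShellL curl_curl_shell_apply curl_shell_eq)
open Summit.NavierStokesRegularity.NavierStokesRegularity.Theorems.UnthreadedRigidity.Persistence (singleShellLambCurlIdentity
  eq_of_cross_gradient_eq_zero_on_sphere differentiableAt_lambPot)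
open Summit.NavierStokesRegularity.NavierStokesRegularity.Theorems.UnthreadedRigidity.CoZonal (twoShellL)

/-! ## ★ The two-shell sphere relation -/

section SphereRelation

/-- the centred potential shell of an ODD-degree harmonic is EVEN. [folklore] -/
theorem shell_neg_of_odd {l : ℕ} {Y : E3 → ℝ} (hY : IsSolidHarmonic l Y) (hl : Odd l) (h : ℝ → ℝ) (z : E3) :
    (fun z : E3 => (h (‖z‖ ^ 2) * Y z) • z) (-z) = (fun z : E3 => (h (‖z‖ ^ 2) * Y z) • z) z := by
  have hodd : Y (-z) = -Y z := by rw [solidHarmonic_apply_neg hY, hl.neg_one_pow]; ring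
  simp only [norm_neg, hodd, mul_neg, neg_smul, smul_neg, neg_neg]

/-- the centred potential shell of an EVEN-degree harmonic is ODD. [folklore] -/
theorem shell_neg_of_even {l : ℕ} {Y : E3 → ℝ} (hY : IsSolidHarmonic l Y) (hl : Even l) (h : ℝ → ℝ) (z : E3) :
    (fun z : E3 => (h (‖z‖ ^ 2) * Y z) • z) (-z) = -(fun z : E3 => (h (‖z‖ ^ 2) * Y z) • z) z := by
  have heven : Y (-z) = Y z := by rw [solidHarmonic_apply_neg hY, hl.neg_one_pow, one_mul]
  simp only [norm_neg, heven, smul_neg]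

/-- ★ **THE TWO-SHELL SPHERE RELATION** (module docstring). -/
theorem twoShell_sphere_relation {l₁ l₂ : ℕ} (hl₁ : Odd l₁) (hl₂ : Even l₂) (hd₁ : 1 ≤ l₁) (hd₂ : 1 ≤ l₂)
    {Y₁ Y₂ : E3 → ℝ} (hY₁ : IsSolidHarmonic l₁ Y₁) (hY₂ : IsSolidHarmonic l₂ Y₂)
    {H₁ H₂ : ℝ → ℝ} (hV₁ : VirialAdmissible l₁ H₁) (hV₂ : VirialAdmissible l₂ H₂) (x₀ : E3)
    (hbal : ∃ e₁ e₂ : ℝ → ℝ, ∀ y : E3,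
      curl (fun x => cross (curl (twoShellL H₁ H₂ Y₁ Y₂ x₀) x) (twoShellL H₁ H₂ Y₁ Y₂ x₀ x)) (x₀ + y) =
        e₁ ‖y‖ • cross (gradient Y₁ y) y + e₂ ‖y‖ • cross (gradient Y₂ y) y)
    {r : ℝ} (hr : 0 < r) :
    ∃ e C : ℝ, ∀ u : E3, ‖u‖ = 1 →
      -(vortAmpL l₁ H₁ r * strainAmpL l₁ H₁ r) * (r ^ ((l₁ : ℤ) - 1)) ^ 2 * ‖gradient Y₁ u‖ ^ 2
        + (l₁ : ℝ) / (2 * r) * (((l₁ : ℝ) - 1) * vortAmpL l₁ H₁ r * deriv H₁ r - ((l₁ : ℝ) + 1) * deriv (vortAmpL l₁ H₁) r * H₁ r)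
            * (r ^ l₁) ^ 2 * Y₁ u ^ 2
        + (-(vortAmpL l₂ H₂ r * strainAmpL l₂ H₂ r) * (r ^ ((l₂ : ℤ) - 1)) ^ 2 * ‖gradient Y₂ u‖ ^ 2
          + (l₂ : ℝ) / (2 * r) * (((l₂ : ℝ) - 1) * vortAmpL l₂ H₂ r * deriv H₂ r - ((l₂ : ℝ) + 1) * deriv (vortAmpL l₂ H₂) r * H₂ r)
              * (r ^ l₂) ^ 2 * Y₂ u ^ 2)
        - e * r ^ l₂ * Y₂ u = C := by
  obtain ⟨e₁, e₂, hbal⟩ := hbal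
  have hY₁d : Differentiable ℝ Y₁ := hY₁.contDiff.differentiable (by simp)
  have hY₂d : Differentiable ℝ Y₂ := hY₂.contDiff.differentiable (by simp)
  -- the two shells, centred, and their parities
  obtain ⟨h₁, hh₁, hHh₁⟩ := hV₁.1
  obtain ⟨h₂, hh₂, hHh₂⟩ := hV₂.1
  set sh₁ : E3 → E3 := fun z => (h₁ (‖z‖ ^ 2) * Y₁ z) • z with hsh₁
  set sh₂ : E3 → E3 := fun z => (h₂ (‖z‖ ^ 2) * Y₂ z) • z with hsh₂
  have hsh₁s : ContDiff ℝ (⊤ : ℕ∞) sh₁ := contDiff_shell hh₁ hY₁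
  have hsh₂s : ContDiff ℝ (⊤ : ℕ∞) sh₂ := contDiff_shell hh₂ hY₂
  set P₁ : E3 → E3 := curl (curl sh₁) with hP₁
  set P₂ : E3 → E3 := curl (curl sh₂) with hP₂
  have hc1 : ContDiff ℝ (⊤ : ℕ∞) (curl sh₁) := contDiff_curl (n := ⊤) (by simpa using hsh₁s)
  have hc2 : ContDiff ℝ (⊤ : ℕ∞) (curl sh₂) := contDiff_curl (n := ⊤) (by simpa using hsh₂s)
  have hP₁s : ContDiff ℝ (⊤ : ℕ∞) P₁ := contDiff_curl (n := ⊤) (by simpa using hc1)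
  have hP₂s : ContDiff ℝ (⊤ : ℕ∞) P₂ := contDiff_curl (n := ⊤) (by simpa using hc2)
  have hω₁s : ContDiff ℝ (⊤ : ℕ∞) (curl P₁) := contDiff_curl (n := ⊤) (by simpa using hP₁s)
  have hω₂s : ContDiff ℝ (⊤ : ℕ∞) (curl P₂) := contDiff_curl (n := ⊤) (by simpa using hP₂s)
  have hP₁d : Differentiable ℝ P₁ := hP₁s.differentiable (by simp)
  have hP₂d : Differentiable ℝ P₂ := hP₂s.differentiable (by simp)
  have hω₁d : Differentiable ℝ (curl P₁) := hω₁s.differentiable (by simp)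
  have hω₂d : Differentiable ℝ (curl P₂) := hω₂s.differentiable (by simp)
  -- parities: `sh₁` even ⇒ `curl sh₁` odd ⇒ `P₁` even ⇒ `ω₁` odd; `sh₂` odd ⇒ … ⇒ `P₂` odd ⇒ `ω₂` even
  have hsh₁e : ∀ z : E3, sh₁ (-z) = sh₁ z := fun z => shell_neg_of_odd hY₁ hl₁ h₁ z
  have hsh₂o : ∀ z : E3, sh₂ (-z) = -sh₂ z := fun z => shell_neg_of_even hY₂ hl₂ h₂ z
  have hcs₁o : ∀ z : E3, curl sh₁ (-z) = -curl sh₁ z := curl_neg_of_even (hsh₁s.differentiable (by simp)) hsh₁e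
  have hcs₂e : ∀ z : E3, curl sh₂ (-z) = curl sh₂ z := curl_neg_of_odd (hsh₂s.differentiable (by simp)) hsh₂o
  have hP₁e : ∀ z : E3, P₁ (-z) = P₁ z := curl_neg_of_odd (hc1.differentiable (by simp)) hcs₁o
  have hP₂o : ∀ z : E3, P₂ (-z) = -P₂ z := curl_neg_of_even (hc2.differentiable (by simp)) hcs₂e
  have hω₁o : ∀ z : E3, curl P₁ (-z) = -curl P₁ z := curl_neg_of_even hP₁d hP₁e
  have hω₂e : ∀ z : E3, curl P₂ (-z) = curl P₂ z := curl_neg_of_odd hP₂d hP₂o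
  -- the slice and its vorticity are translates
  set S₁ : E3 → E3 := sepShellL H₁ Y₁ x₀ with hS₁
  set S₂ : E3 → E3 := sepShellL H₂ Y₂ x₀ with hS₂
  have hS₁e : S₁ = fun x => P₁ (x - x₀) := by rw [hS₁, sepShellL_eq_comp_sub hHh₁ Y₁ x₀]
  have hS₂e : S₂ = fun x => P₂ (x - x₀) := by rw [hS₂, sepShellL_eq_comp_sub hHh₂ Y₂ x₀]
  have hωS₁ : curl S₁ = fun x => curl P₁ (x - x₀) := by rw [hS₁e, curl_comp_sub_const_fun]
  have hωS₂ : curl S₂ = fun x => curl P₂ (x - x₀) := by rw [hS₂e, curl_comp_sub_const_fun]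
  have hS₁d : Differentiable ℝ S₁ := by rw [hS₁e]; exact fun x => (hP₁d _).comp x (differentiableAt_id.sub_const x₀)
  have hS₂d : Differentiable ℝ S₂ := by rw [hS₂e]; exact fun x => (hP₂d _).comp x (differentiableAt_id.sub_const x₀)
  have hcS₁d : Differentiable ℝ (curl S₁) := by
    rw [hωS₁]; exact fun x => (hω₁d _).comp x (differentiableAt_id.sub_const x₀)
  have hcS₂d : Differentiable ℝ (curl S₂) := by
    rw [hωS₂]; exact fun x => (hω₂d _).comp x (differentiableAt_id.sub_const x₀)
  have hu : twoShellL H₁ H₂ Y₁ Y₂ x₀ = fun x => S₁ x + S₂ x := rfl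
  have hcurlu : curl (twoShellL H₁ H₂ Y₁ Y₂ x₀) = fun x => curl S₁ x + curl S₂ x := by
    funext x; rw [hu]; exact curl_add (hS₁d x) (hS₂d x)
  -- the Lamb vector field splits: self terms + cross terms
  set X : E3 → E3 := fun x => cross (curl S₁ x) (S₂ x) + cross (curl S₂ x) (S₁ x) with hX
  have hadd_l : ∀ p q m : E3, cross (p + q) m = cross p m + cross q m := fun p q m => by
    rw [← crossCLM_apply (p + q) m, map_add]; rfl
  have hadd_r : ∀ p m n : E3, cross p (m + n) = cross p m + cross p n := fun p m n => by
    rw [← crossCLM_apply p (m + n), map_add, crossCLM_apply, crossCLM_apply]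
  have hLamb : (fun x => cross (curl (twoShellL H₁ H₂ Y₁ Y₂ x₀) x) (twoShellL H₁ H₂ Y₁ Y₂ x₀ x)) =
      fun x => (cross (curl S₁ x) (S₁ x) + cross (curl S₂ x) (S₂ x)) + X x := by
    funext x
    rw [hcurlu, hu, hX]
    simp only [hadd_l, hadd_r]
    abel
  -- differentiability of the pieces
  have hdc : ∀ {f g : E3 → E3}, Differentiable ℝ f → Differentiable ℝ g → Differentiable ℝ (fun x => cross (f x) (g x)) :=
    fun hf hg x => (hasFDerivAt_cross (hf x).hasFDerivAt (hg x).hasFDerivAt).differentiableAt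
  have hL₁d : Differentiable ℝ (fun x => cross (curl S₁ x) (S₁ x)) := hdc hcS₁d hS₁d
  have hL₂d : Differentiable ℝ (fun x => cross (curl S₂ x) (S₂ x)) := hdc hcS₂d hS₂d
  have hXd : Differentiable ℝ X := by rw [hX]; exact (hdc hcS₁d hS₂d).add (hdc hcS₂d hS₁d)
  -- the cross term is EVEN about `x₀`, so its curl is ODD
  set Xc : E3 → E3 := fun y => X (x₀ + y) with hXc
  have hXc_eval : ∀ z : E3, Xc z = cross (curl P₁ z) (P₂ z) + cross (curl P₂ z) (P₁ z) := by
    intro z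
    simp only [hXc, hX]
    rw [hωS₁, hωS₂, hS₁e, hS₂e]
    simp only [add_sub_cancel_left]
  have hXce : ∀ y : E3, Xc (-y) = Xc y := by
    intro y
    rw [hXc_eval, hXc_eval, hω₁o, hP₂o, hω₂e, hP₁e, cross_neg_neg]
  have hXcd : Differentiable ℝ Xc := fun y => (hXd _).comp y ((differentiableAt_const x₀).add differentiableAt_id)
  have hXtr : X = fun x => Xc (x - x₀) := by funext x; simp [hXc]
  have hcurlX : ∀ y : E3, curl X (x₀ + y) = curl Xc y := by
    intro y; rw [hXtr, curl_comp_sub_const_fun]; simp only [add_sub_cancel_left]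
  have hcurlXo : ∀ y : E3, curl Xc (-y) = -curl Xc y := curl_neg_of_even hXcd hXce
  -- the self terms by the single-shell Lamb-curl identity
  set ψ₁ : E3 → ℝ := fun y => -(vortAmpL l₁ H₁ ‖y‖ * strainAmpL l₁ H₁ ‖y‖) * ‖gradient Y₁ y‖ ^ 2
      + (l₁ : ℝ) / (2 * ‖y‖) * (((l₁ : ℝ) - 1) * vortAmpL l₁ H₁ ‖y‖ * deriv H₁ ‖y‖
          - ((l₁ : ℝ) + 1) * deriv (vortAmpL l₁ H₁) ‖y‖ * H₁ ‖y‖) * Y₁ y ^ 2 with hψ₁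
  set ψ₂ : E3 → ℝ := fun y => -(vortAmpL l₂ H₂ ‖y‖ * strainAmpL l₂ H₂ ‖y‖) * ‖gradient Y₂ y‖ ^ 2
      + (l₂ : ℝ) / (2 * ‖y‖) * (((l₂ : ℝ) - 1) * vortAmpL l₂ H₂ ‖y‖ * deriv H₂ ‖y‖
          - ((l₂ : ℝ) + 1) * deriv (vortAmpL l₂ H₂) ‖y‖ * H₂ ‖y‖) * Y₂ y ^ 2 with hψ₂
  have hA₁ : ∀ y : E3, y ≠ 0 → curl (fun x => cross (curl S₁ x) (S₁ x)) (x₀ + y) = cross (gradient ψ₁ y) y :=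
    fun y hy => singleShellLambCurlIdentity l₁ H₁ Y₁ x₀ hd₁ hY₁ hV₁ y hy
  have hA₂ : ∀ y : E3, y ≠ 0 → curl (fun x => cross (curl S₂ x) (S₂ x)) (x₀ + y) = cross (gradient ψ₂ y) y :=
    fun y hy => singleShellLambCurlIdentity l₂ H₂ Y₂ x₀ hd₂ hY₂ hV₂ y hy
  -- `ψᵢ` are even
  have hgY₁ : ∀ y : E3, gradient Y₁ (-y) = gradient Y₁ y := fun y => solidHarmonic_gradient_neg_of_odd hY₁ hl₁ y
  have hgY₂ : ∀ y : E3, gradient Y₂ (-y) = -gradient Y₂ y := fun y => solidHarmonic_gradient_neg_of_even hY₂ hl₂ y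
  have hY₁n : ∀ y : E3, Y₁ (-y) = -Y₁ y := fun y => by rw [solidHarmonic_apply_neg hY₁, hl₁.neg_one_pow]; ring
  have hY₂n : ∀ y : E3, Y₂ (-y) = Y₂ y := fun y => by rw [solidHarmonic_apply_neg hY₂, hl₂.neg_one_pow, one_mul]
  have hψ₁e : ∀ y : E3, ψ₁ (-y) = ψ₁ y := fun y => by simp only [hψ₁, norm_neg, hgY₁, hY₁n, neg_sq]
  have hψ₂e : ∀ y : E3, ψ₂ (-y) = ψ₂ y := fun y => by simp only [hψ₂, norm_neg, hgY₂, norm_neg, hY₂n]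
  have hψ₁d : ∀ y : E3, y ≠ 0 → DifferentiableAt ℝ ψ₁ y := fun y hy => differentiableAt_lambPot l₁ hV₁ hY₁ hy
  have hψ₂d : ∀ y : E3, y ≠ 0 → DifferentiableAt ℝ ψ₂ y := fun y hy => differentiableAt_lambPot l₂ hV₂ hY₂ hy
  -- THE EVEN PART OF THE BALANCE: `∇ψ₁ × y + ∇ψ₂ × y = e₂(|y|) ∇Y₂ × y`
  have hsplit : ∀ z : E3, curl (fun x => (cross (curl S₁ x) (S₁ x) + cross (curl S₂ x) (S₂ x)) + X x) z =
      curl (fun x => cross (curl S₁ x) (S₁ x)) z + curl (fun x => cross (curl S₂ x) (S₂ x)) z + curl X z := by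
    intro z
    have h1 : DifferentiableAt ℝ (fun x => cross (curl S₁ x) (S₁ x) + cross (curl S₂ x) (S₂ x)) z :=
      (hL₁d z).add (hL₂d z)
    rw [curl_add h1 (hXd z), curl_add (hL₁d z) (hL₂d z)]
  have heven : ∀ y : E3, y ≠ 0 → cross (gradient ψ₁ y) y + cross (gradient ψ₂ y) y = e₂ ‖y‖ • cross (gradient Y₂ y) y := by
    intro y hy
    have hy' : -y ≠ 0 := neg_ne_zero.2 hy
    -- the balance at `y` and at `−y`, with all pieces evaluated
    have hb : cross (gradient ψ₁ y) y + cross (gradient ψ₂ y) y + curl Xc y =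
        e₁ ‖y‖ • cross (gradient Y₁ y) y + e₂ ‖y‖ • cross (gradient Y₂ y) y := by
      have h := hbal y
      rwa [hLamb, hsplit, hA₁ y hy, hA₂ y hy, hcurlX] at h
    have hb' : cross (gradient ψ₁ y) y + cross (gradient ψ₂ y) y - curl Xc y =
        -(e₁ ‖y‖ • cross (gradient Y₁ y) y) + e₂ ‖y‖ • cross (gradient Y₂ y) y := by
      have h := hbal (-y)
      rw [hLamb, hsplit, hA₁ (-y) hy', hA₂ (-y) hy', hcurlX, hcurlXo, norm_neg, gradient_at_neg_of_even hψ₁e (hψ₁d y hy),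
        gradient_at_neg_of_even hψ₂e (hψ₂d y hy), cross_neg_neg, cross_neg_neg, carrier_neg_of_odd hY₁ hl₁,
        carrier_neg_of_even hY₂ hl₂, smul_neg, ← sub_eq_add_neg] at h
      exact h
    have hsum := congrArg₂ (· + ·) hb hb'
    have h2 : (2 : ℝ) • (cross (gradient ψ₁ y) y + cross (gradient ψ₂ y) y) = (2 : ℝ) • (e₂ ‖y‖ • cross (gradient Y₂ y) y) := by
      rw [two_smul, two_smul]
      convert hsum using 1 <;> abel
    exact smul_right_injective E3 (two_ne_zero) h2
  -- ON EACH SPHERE `ψ₁ + ψ₂ − e₂(r) Y₂` IS CONSTANT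
  set F : E3 → ℝ := fun y => ψ₁ y + ψ₂ y - e₂ r * Y₂ y with hF
  have hFd : ∀ y : E3, ‖y‖ = r → DifferentiableAt ℝ F y := fun y hy => by
    have hy0 : y ≠ 0 := by rw [← norm_ne_zero_iff, hy]; exact hr.ne'
    exact ((hψ₁d y hy0).add (hψ₂d y hy0)).sub ((hY₂d y).const_mul _)
  have hFrad : ∀ y : E3, ‖y‖ = r → cross (gradient F y) y = 0 := by
    intro y hy
    have hy0 : y ≠ 0 := by rw [← norm_ne_zero_iff, hy]; exact hr.ne'
    have hgrad : gradient F y = gradient ψ₁ y + gradient ψ₂ y - (e₂ r) • gradient Y₂ y := by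
      have hd12 : DifferentiableAt ℝ (fun z => ψ₁ z + ψ₂ z) y := (hψ₁d y hy0).add (hψ₂d y hy0)
      have hd3 : DifferentiableAt ℝ (fun z => e₂ r * Y₂ z) y := (hY₂d y).const_mul _
      rw [hF, gradient, fderiv_fun_sub hd12 hd3, fderiv_fun_add (hψ₁d y hy0) (hψ₂d y hy0), fderiv_const_mul (hY₂d y),
        map_sub, map_add, map_smul]
      rfl
    have hlin : cross (gradient ψ₁ y + gradient ψ₂ y - (e₂ r) • gradient Y₂ y) y =
        cross (gradient ψ₁ y) y + cross (gradient ψ₂ y) y - (e₂ r) • cross (gradient Y₂ y) y := by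
      rw [← crossCLM_apply (gradient ψ₁ y + gradient ψ₂ y - (e₂ r) • gradient Y₂ y) y, map_sub, map_add, map_smul]
      rfl
    rw [hgrad, hlin, heven y hy0, hy, sub_self]
  -- transport to the unit sphere (homogeneity of the harmonics and their gradients)
  have hru : ∀ u : E3, ‖u‖ = 1 → ‖(r : ℝ) • u‖ = r := fun u hu => by
    rw [norm_smul, Real.norm_eq_abs, abs_of_pos hr, hu, mul_one]
  have hval : ∀ u : E3, ‖u‖ = 1 → F (r • u) =
      -(vortAmpL l₁ H₁ r * strainAmpL l₁ H₁ r) * (r ^ ((l₁ : ℤ) - 1)) ^ 2 * ‖gradient Y₁ u‖ ^ 2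
        + (l₁ : ℝ) / (2 * r) * (((l₁ : ℝ) - 1) * vortAmpL l₁ H₁ r * deriv H₁ r - ((l₁ : ℝ) + 1) * deriv (vortAmpL l₁ H₁) r * H₁ r)
            * (r ^ l₁) ^ 2 * Y₁ u ^ 2
        + (-(vortAmpL l₂ H₂ r * strainAmpL l₂ H₂ r) * (r ^ ((l₂ : ℤ) - 1)) ^ 2 * ‖gradient Y₂ u‖ ^ 2
          + (l₂ : ℝ) / (2 * r) * (((l₂ : ℝ) - 1) * vortAmpL l₂ H₂ r * deriv H₂ r - ((l₂ : ℝ) + 1) * deriv (vortAmpL l₂ H₂) r * H₂ r)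
              * (r ^ l₂) ^ 2 * Y₂ u ^ 2)
        - e₂ r * r ^ l₂ * Y₂ u := by
    intro u hu
    have hY₁s : Y₁ (r • u) = r ^ l₁ * Y₁ u := hY₁.apply_smul r u
    have hY₂s : Y₂ (r • u) = r ^ l₂ * Y₂ u := hY₂.apply_smul r u
    have hg₁ : ‖gradient Y₁ (r • u)‖ ^ 2 = (r ^ ((l₁ : ℤ) - 1)) ^ 2 * ‖gradient Y₁ u‖ ^ 2 := by
      rw [hY₁.gradient_smul r hr u, norm_smul, mul_pow, Real.norm_eq_abs, sq_abs]
    have hg₂ : ‖gradient Y₂ (r • u)‖ ^ 2 = (r ^ ((l₂ : ℤ) - 1)) ^ 2 * ‖gradient Y₂ u‖ ^ 2 := by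
      rw [hY₂.gradient_smul r hr u, norm_smul, mul_pow, Real.norm_eq_abs, sq_abs]
    simp only [hF, hψ₁, hψ₂, hru u hu, hY₁s, hY₂s, hg₁, hg₂]
    ring
  have hu₀n : ‖e 0‖ = 1 := by simp [e]
  refine ⟨e₂ r, F (r • e 0), fun u hu => ?_⟩
  rw [← hval u hu]
  exact eq_of_cross_gradient_eq_zero_on_sphere hr hFd hFrad (hru u hu) (hru (e 0) hu₀n)

end SphereRelation

end Summit.NavierStokesRegularity.NavierStokesRegularity.Theorems.UnthreadedRigidity.MixedPair

end
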